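import Literature.AnabelianGeometry.SemiGraphs.TemperedVerticial
import Literature.AnabelianGeometry.SemiGraphs.BTempStructureProofs
import HarnessLib

/-!
# [SemiAnbd] Theorem 3.7 (i): the verticial homomorphisms `π̂₁(G_v) → π₁^temp(G)` are injective

Mochizuki, *Semi-graphs of anabelioids*, Publ. RIMS **42** (2006), §3, manuscript p. 40
[cite: MochizukiSemiAnbd2006, Thm 3.7(i) p.40], with the gluing construction of the proof of
Proposition 2.5 (i), p. 27 [cite: MochizukiSemiAnbd2006, Prop 2.5 p.27]; companion of
`TemperedVerticial.lean` (the named fact `ProfiniteSemiGraph.VerticialInjective`), in the local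
presentation `ProfiniteSemiGraph` / `CovObj` / `TemperedPiChart` of `TemperedCoverings.lean`.

Print proves Theorem 3.7 (i) as "in light of the injection of Proposition 3.6 (iii)
[`π₁^temp(G) ↪ π̂₁(G)`] … Proposition 2.5 (i) [`Π_v ↪ Π_G`]". Here the INJECTIVITY clause is proved
directly in `B^temp(G)`, by the argument of the proof of Proposition 2.5 (i) (p. 27):

* `Approximator.trivCov` — for an approximator `G → G'` (Def. 2.3 (ii), the local rendering
  `ProfiniteSemiGraph.Approximator`) and `M` divisible by all `[Π'_v : 1]`, "a finite étale covering
  of `G` each of whose constituent anabelioids is trivial [over `G'`]": over a component `c`, the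
  union of `M/[Π'_c : 1]` copies of the universal covering of `G'_c` (`objV`, `objE`), the copies
  glued along the branches "by choosing appropriate gluing isomorphisms" (`glue`: both sides are
  free `Π'_e`-sets of cardinality `M`, and two free sets of equal finite cardinality under a finite
  group are isomorphic, `exists_equivariant_equiv_of_free`). It is a finite object of `B^cov(G)`
  which splits itself at every point, hence is TEMPERED (`trivCov_isTempered`) — no appeal to
  Galois closures is needed.
* `verticialHom_injective` — for `G` quasi-coherent (Def. 2.3 (iii)), every verticial homomorphism
  `ψ : Π_v → π₁^temp(G)` (`IsVerticialHom`) is injective: an element of `Ker ψ` fixes the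
  `v`-constituent of every tempered covering (`IsVerticialHom.ρ_eq_self_of_map_eq_one`: `S_v` is
  identified with the restriction along `ψ` of the chart image of `S`), whereas for `g ≠ 1`, an open
  normal `U ∌ g` and the approximator that quasi-coherence attaches to `Π_v/U` give a trivialising
  covering on whose `v`-points `g` acts freely.
* `verticialInjective_iff_nonempty` — the named fact `VerticialInjective` (Thm. 3.7 (i) as typed:
  existence AND injectivity) is thereby REDUCED to its existence clause (a verticial homomorphism at
  every vertex = Proposition 3.2 applied to the morphism of temperoids `B^temp(G) → G_v^⊤`; sequel).

Nothing here takes a side on any disputed step; the statements discharged are [SemiAnbd]'s own.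
-/

open CategoryTheory Topology

namespace Literature.AnabelianGeometry.SemiGraphs

universe u

/-! ### Equivariance and transport in `B^temp(Π)` -/

section BTempTools

variable {G : Type u} [Group G] [TopologicalSpace G]

/-- Equivariance of a morphism of `B^temp(Π)`, pointwise.
[cite: MochizukiSemiAnbd2006, §3 p.33] -/
private theorem hom_ρ_apply {X Y : BTemp G} (f : X ⟶ Y) (g : G) (x : X.obj.V) :
    f.hom.hom (X.obj.ρ g x) = Y.obj.ρ g (f.hom.hom x) := by
  have e := ConcreteCategory.congr_hom (f.hom.comm g) x
  simp only [types_comp_apply] at e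
  exact e

/-- Along an isomorphism `X ≅ res_φ Y` of `B^temp(Π)`, an element of `Ker φ` acts trivially on `X`.
[cite: MochizukiSemiAnbd2006, §3 p.34] -/
theorem BTemp.ρ_eq_self_of_iso_res {H : Type u} [Group H] [TopologicalSpace H] (φ : G →ₜ* H)
    {X : BTemp G} {Y : BTemp H} (i : X ≅ (BTemp.res φ).obj Y) {g : G} (hg : φ g = 1)
    (x : X.obj.V) : X.obj.ρ g x = x := by
  have hinj := (BTemp.mono_iff_injective i.hom).mp inferInstance
  apply hinj
  change i.hom.hom.hom (X.obj.ρ g x) = i.hom.hom.hom x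
  rw [hom_ρ_apply]
  change Y.obj.ρ (φ g) (i.hom.hom.hom x) = i.hom.hom.hom x
  rw [hg, map_one]
  rfl

end BTempTools

/-! ### Free actions of finite groups: two free `F`-sets of the same finite cardinality are isomorphic -/

section FreeActions

variable {F : Type*} [Group F] {X : Type*} [MulAction F X]

open MulAction in
/-- For a free action, `(ω, f) ↦ f • ω.out` is a bijection from (orbit space) `× F` onto `X`.
[folklore] -/
private theorem bijective_smul_out (hfree : ∀ (f : F) (x : X), f • x = x → f = 1) :
    Function.Bijective fun p : orbitRel.Quotient F X × F => p.2 • p.1.out := by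
  constructor
  · rintro ⟨ω₁, f₁⟩ ⟨ω₂, f₂⟩ h
    dsimp only at h
    have hω : ω₁ = ω₂ := by
      rw [← Quotient.out_eq ω₁, ← Quotient.out_eq ω₂]
      refine Quotient.sound ?_
      change ω₁.out ∈ MulAction.orbit F ω₂.out
      refine ⟨f₁⁻¹ * f₂, ?_⟩
      simp only [mul_smul, ← h, inv_smul_smul]
    subst hω
    have hfix : (f₂⁻¹ * f₁) • ω₁.out = ω₁.out := by rw [mul_smul, h, inv_smul_smul]
    have := hfree _ _ hfix
    rw [inv_mul_eq_one] at this
    rw [this]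
  · intro x
    have hx : (Quotient.mk (orbitRel F X) x).out ∈ MulAction.orbit F x :=
      Quotient.exact (Quotient.out_eq (Quotient.mk (orbitRel F X) x))
    obtain ⟨f, hf⟩ := hx
    refine ⟨(Quotient.mk (orbitRel F X) x, f⁻¹), ?_⟩
    dsimp only
    rw [← hf, inv_smul_smul]

open MulAction in
/-- For a free action of a finite group on a finite set, `|X| = |X/F| · |F|`. [folklore] -/
private theorem card_eq_card_quotient_mul (hfree : ∀ (f : F) (x : X), f • x = x → f = 1) :
    Nat.card X = Nat.card (orbitRel.Quotient F X) * Nat.card F := by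
  rw [← Nat.card_prod]
  exact (Nat.card_congr (Equiv.ofBijective _ (bijective_smul_out hfree))).symm

/-- Two finite free `F`-sets of the same cardinality are `F`-isomorphic. [folklore] -/
private theorem exists_equivariant_equiv_of_free [Finite F] {Y : Type*} [MulAction F Y] [Finite X] [Finite Y]
    (hX : ∀ (f : F) (x : X), f • x = x → f = 1) (hY : ∀ (f : F) (y : Y), f • y = y → f = 1)
    (hcard : Nat.card X = Nat.card Y) :
    ∃ e : X ≃ Y, ∀ (f : F) (x : X), e (f • x) = f • e x := by
  classical
  let eX := Equiv.ofBijective _ (bijective_smul_out hX)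
  let eY := Equiv.ofBijective _ (bijective_smul_out hY)
  have hq : Nat.card (MulAction.orbitRel.Quotient F X) = Nat.card (MulAction.orbitRel.Quotient F Y) := by
    have h1 := card_eq_card_quotient_mul hX
    have h2 := card_eq_card_quotient_mul hY
    have hF : 0 < Nat.card F := Nat.card_pos
    rw [hcard, h2] at h1
    exact (Nat.eq_of_mul_eq_mul_right hF h1).symm
  haveI : Finite (MulAction.orbitRel.Quotient F X) := Quotient.finite _
  haveI : Finite (MulAction.orbitRel.Quotient F Y) := Quotient.finite _
  obtain ⟨σ⟩ := Finite.card_eq.mp hq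
  refine ⟨eX.symm.trans ((σ.prodCongr (Equiv.refl F)).trans eY), fun f x => ?_⟩
  obtain ⟨⟨ω, f₀⟩, rfl⟩ := eX.surjective x
  have h1 : f • eX (ω, f₀) = eX (ω, f * f₀) := by
    simp only [eX, Equiv.ofBijective_apply, mul_smul]
  rw [h1, Equiv.trans_apply, Equiv.trans_apply, Equiv.symm_apply_apply, Equiv.trans_apply,
    Equiv.trans_apply, Equiv.symm_apply_apply]
  simp only [eY, Equiv.prodCongr_apply, Prod.map, Equiv.refl_apply, Equiv.ofBijective_apply,
    mul_smul]

end FreeActions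

/-- `K` acting on `K × T` by left multiplication on the first factor (the "union of copies of the
universal covering" of a finite constituent `B(K)`, p. 27). [folklore] -/
@[reducible] def prodLeftAction (K : Type*) [Group K] (T : Type*) : MulAction K (K × T) where
  smul k p := (k * p.1, p.2)
  one_smul p := Prod.ext (one_mul p.1) rfl
  mul_smul k k' p := Prod.ext (mul_assoc k k' p.1) rfl

section BTempIso

variable {G : Type u} [Group G] [TopologicalSpace G]

/-- An equivariant bijection of underlying sets is an isomorphism of `B^temp(Π)` (a full
subcategory of `Π`-sets). [cite: MochizukiSemiAnbd2006, §3 p.33] -/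
def BTemp.isoOfEquiv {X Y : BTemp G} (e : X.obj.V ≃ Y.obj.V)
    (he : ∀ (g : G) (x : X.obj.V), e (X.obj.ρ g x) = Y.obj.ρ g (e x)) : X ≅ Y :=
  ObjectProperty.isoMk _ (Action.mkIso e.toIso fun g =>
    ConcreteCategory.hom_ext _ _ fun x => by
      simp only [types_comp_apply]
      exact he g x)

end BTempIso

namespace ProfiniteSemiGraph

variable {𝒢 : ProfiniteSemiGraph.{u}}

namespace Approximator

variable (A : 𝒢.Approximator) (M : ℕ)

/-- Multiplicity `M/[Π'_v : 1]` of the universal covering of `G'_v` in the trivialising covering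
(p. 27), floored at `1`. [cite: MochizukiSemiAnbd2006, Prop 2.5 p.27] -/
noncomputable def multV (w : 𝒢.graph.Vertex) : ℕ := max 1 (M / Nat.card (A.FV w))

/-- Multiplicity `M/[Π'_e : 1]` over an edge, floored at `1`. [cite: MochizukiSemiAnbd2006, Prop 2.5 p.27] -/
noncomputable def multE (e : 𝒢.graph.Edge) : ℕ := max 1 (M / Nat.card (A.FE e))

/-- `Π_v` acting on `Π'_v × (M/[Π'_v:1])` through `Π_v → Π'_v`. [cite: MochizukiSemiAnbd2006, Prop 2.5 p.27] -/
@[reducible] noncomputable def actionV (w : 𝒢.graph.Vertex) :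
    MulAction (𝒢.Gv w) (A.FV w × Fin (A.multV M w)) :=
  @MulAction.compHom (A.FV w) (𝒢.Gv w) (A.FV w × Fin (A.multV M w)) _
    (prodLeftAction (A.FV w) (Fin (A.multV M w))) _ (A.πV w)

/-- `Π_e` acting on `Π'_e × (M/[Π'_e:1])` through `Π_e → Π'_e`. [cite: MochizukiSemiAnbd2006, Prop 2.5 p.27] -/
@[reducible] noncomputable def actionE (e : 𝒢.graph.Edge) :
    MulAction (𝒢.Ge e) (A.FE e × Fin (A.multE M e)) :=
  @MulAction.compHom (A.FE e) (𝒢.Ge e) (A.FE e × Fin (A.multE M e)) _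
    (prodLeftAction (A.FE e) (Fin (A.multE M e))) _ (A.πE e)

/-- The `v`-constituent of the trivialising covering: `M/[Π'_v:1]` copies of the universal
covering of `G'_v`, an object of `G_v^⊤ = B^temp(Π_v)` (finite; stabilisers `= Ker(Π_v → Π'_v)`,
open). [cite: MochizukiSemiAnbd2006, Prop 2.5 p.27] -/
noncomputable def objV (w : 𝒢.graph.Vertex) : BTemp (𝒢.Gv w) :=
  ⟨@Action.ofMulAction (𝒢.Gv w) (A.FV w × Fin (A.multV M w)) _ (A.actionV M w), by
    refine ⟨inferInstanceAs (Countable (A.FV w × Fin (A.multV M w))), fun p => ?_⟩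
    have : {x : 𝒢.Gv w | (@Action.ofMulAction (𝒢.Gv w) (A.FV w × Fin (A.multV M w)) _
        (A.actionV M w)).ρ x p = p} = ((A.πV w).ker : Set (𝒢.Gv w)) := by
      ext x
      simp only [Set.mem_setOf_eq, SetLike.mem_coe, MonoidHom.mem_ker]
      change (A.πV w x * p.1, p.2) = p ↔ _
      rw [Prod.ext_iff, and_iff_left rfl]
      exact mul_eq_right
    rw [this]
    exact A.isOpen_ker_πV w⟩

/-- The `e`-constituent of the trivialising covering. [cite: MochizukiSemiAnbd2006, Prop 2.5 p.27] -/
noncomputable def objE (e : 𝒢.graph.Edge) : BTemp (𝒢.Ge e) :=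
  ⟨@Action.ofMulAction (𝒢.Ge e) (A.FE e × Fin (A.multE M e)) _ (A.actionE M e), by
    refine ⟨inferInstanceAs (Countable (A.FE e × Fin (A.multE M e))), fun p => ?_⟩
    have : {x : 𝒢.Ge e | (@Action.ofMulAction (𝒢.Ge e) (A.FE e × Fin (A.multE M e)) _
        (A.actionE M e)).ρ x p = p} = ((A.πE e).ker : Set (𝒢.Ge e)) := by
      ext x
      simp only [Set.mem_setOf_eq, SetLike.mem_coe, MonoidHom.mem_ker]
      change (A.πE e x * p.1, p.2) = p ↔ _
      rw [Prod.ext_iff, and_iff_left rfl]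
      exact mul_eq_right
    rw [this]
    exact A.isOpen_ker_πE e⟩

/-- The action on the `v`-constituent, unfolded. [cite: MochizukiSemiAnbd2006, Prop 2.5 p.27] -/
theorem objV_ρ (w : 𝒢.graph.Vertex) (x : 𝒢.Gv w) (p : A.FV w × Fin (A.multV M w)) :
    (A.objV M w).obj.ρ x p = (A.πV w x * p.1, p.2) := rfl

/-- The action on the `e`-constituent, unfolded. [cite: MochizukiSemiAnbd2006, Prop 2.5 p.27] -/
theorem objE_ρ (e : 𝒢.graph.Edge) (x : 𝒢.Ge e) (p : A.FE e × Fin (A.multE M e)) :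
    (A.objE M e).obj.ρ x p = (A.πE e x * p.1, p.2) := rfl

variable {M}

/-- `[Π'_e : 1] · (M/[Π'_e : 1]) = M` for an edge with an abutting branch: `Π'_e ↪ Π'_v` and
`[Π'_v : 1] ∣ M`. [cite: MochizukiSemiAnbd2006, Prop 2.5 p.27] -/
theorem card_objE (hM : 0 < M) (hdvd : ∀ w, Nat.card (A.FV w) ∣ M) (b : 𝒢.graph.Branch)
    (v : 𝒢.graph.Vertex) (h : 𝒢.graph.abuts b = some v) :
    Nat.card (A.FE (𝒢.graph.edgeOf b) × Fin (A.multE M (𝒢.graph.edgeOf b))) = M := by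
  have hE : Nat.card (A.FE (𝒢.graph.edgeOf b)) ∣ M :=
    (Subgroup.card_dvd_of_injective _ (A.brF_injective b v h)).trans (hdvd v)
  have hpos : 0 < Nat.card (A.FE (𝒢.graph.edgeOf b)) := Nat.card_pos
  have h1 : 1 ≤ M / Nat.card (A.FE (𝒢.graph.edgeOf b)) :=
    Nat.div_pos (Nat.le_of_dvd hM hE) hpos
  rw [Nat.card_prod, Nat.card_eq_fintype_card (α := Fin _), Fintype.card_fin, multE,
    max_eq_right h1]
  exact Nat.mul_div_cancel' hE

/-- `[Π'_v : 1] · (M/[Π'_v : 1]) = M`. [cite: MochizukiSemiAnbd2006, Prop 2.5 p.27] -/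
theorem card_objV (hM : 0 < M) (hdvd : ∀ w, Nat.card (A.FV w) ∣ M) (v : 𝒢.graph.Vertex) :
    Nat.card (A.FV v × Fin (A.multV M v)) = M := by
  have hpos : 0 < Nat.card (A.FV v) := Nat.card_pos
  have h1 : 1 ≤ M / Nat.card (A.FV v) := Nat.div_pos (Nat.le_of_dvd hM (hdvd v)) hpos
  rw [Nat.card_prod, Nat.card_eq_fintype_card (α := Fin _), Fintype.card_fin, multV,
    max_eq_right h1]
  exact Nat.mul_div_cancel' (hdvd v)

/-- The gluing `S_e ≅ b^* S_v` of the trivialising covering along a branch `b` of `e` abutting to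
`v` ("by choosing appropriate gluing isomorphisms", p. 27): both sides are free
`Π'_e`-sets of cardinality `M` — `Π'_e` acting on `b^* S_v` through `γ_{g⁻¹} ∘ b'_*`, where `g`
is the 2-cell of the approximator at `b` — hence isomorphic.
[cite: MochizukiSemiAnbd2006, Prop 2.5 p.27] -/
theorem exists_glueEquiv (hM : 0 < M) (hdvd : ∀ w, Nat.card (A.FV w) ∣ M) (b : 𝒢.graph.Branch)
    (v : 𝒢.graph.Vertex) (h : 𝒢.graph.abuts b = some v) :
    ∃ e : (A.objE M (𝒢.graph.edgeOf b)).obj.V ≃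
        ((BTemp.res (𝒢.brHom b v h)).obj (A.objV M v)).obj.V,
      ∀ (x : 𝒢.Ge (𝒢.graph.edgeOf b)) (p : (A.objE M (𝒢.graph.edgeOf b)).obj.V),
        e ((A.objE M (𝒢.graph.edgeOf b)).obj.ρ x p) =
          ((BTemp.res (𝒢.brHom b v h)).obj (A.objV M v)).obj.ρ x (e p) := by
  classical
  obtain ⟨g, hg⟩ := A.comm b v h
  -- `Π'_e` acting on `Π'_v × (M/[Π'_v:1])` through `f ↦ g⁻¹ b'_*(f) g`
  let θ : A.FE (𝒢.graph.edgeOf b) →* A.FV v :=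
    (MulAut.conj g⁻¹).toMonoidHom.comp (A.brF b v h)
  have hθ : ∀ f, θ f = g⁻¹ * A.brF b v h f * g := fun f => by
    simp [θ]
  have hθinj : Function.Injective θ := fun f₁ f₂ hf => by
    rw [hθ, hθ] at hf
    exact A.brF_injective b v h (mul_left_cancel (mul_right_cancel hf))
  letI iX : MulAction (A.FE (𝒢.graph.edgeOf b))
      (A.FE (𝒢.graph.edgeOf b) × Fin (A.multE M (𝒢.graph.edgeOf b))) :=
    prodLeftAction _ _
  letI iY : MulAction (A.FE (𝒢.graph.edgeOf b)) (A.FV v × Fin (A.multV M v)) :=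
    @MulAction.compHom (A.FV v) (A.FE (𝒢.graph.edgeOf b)) (A.FV v × Fin (A.multV M v)) _
      (prodLeftAction (A.FV v) (Fin (A.multV M v))) _ θ
  have hX : ∀ (f : A.FE (𝒢.graph.edgeOf b))
      (p : A.FE (𝒢.graph.edgeOf b) × Fin (A.multE M (𝒢.graph.edgeOf b))),
      f • p = p → f = 1 := fun f p hp => by
    change (f * p.1, p.2) = p at hp
    exact mul_eq_right.mp (congrArg Prod.fst hp)
  have hY : ∀ (f : A.FE (𝒢.graph.edgeOf b)) (p : A.FV v × Fin (A.multV M v)),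
      f • p = p → f = 1 := fun f p hp => hθinj (by
    change (θ f * p.1, p.2) = p at hp
    rw [map_one]
    exact mul_eq_right.mp (congrArg Prod.fst hp))
  obtain ⟨e, he⟩ := exists_equivariant_equiv_of_free hX hY
    ((A.card_objE hM hdvd b v h).trans (A.card_objV hM hdvd v).symm)
  refine ⟨e, fun x p => ?_⟩
  change A.FE (𝒢.graph.edgeOf b) × Fin (A.multE M (𝒢.graph.edgeOf b)) at p
  change e (A.πE _ x • p) = (A.πV v (𝒢.brHom b v h x) * (e p).1, (e p).2)
  rw [he]
  change (θ (A.πE _ x) * (e p).1, (e p).2) = _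
  rw [hθ, hg]
  simp only [mul_assoc, inv_mul_cancel_left]

/-- A chosen gluing isomorphism along `b`. [cite: MochizukiSemiAnbd2006, Prop 2.5 p.27] -/
noncomputable def glue (hM : 0 < M) (hdvd : ∀ w, Nat.card (A.FV w) ∣ M) (b : 𝒢.graph.Branch)
    (v : 𝒢.graph.Vertex) (h : 𝒢.graph.abuts b = some v) :
    A.objE M (𝒢.graph.edgeOf b) ≅ (BTemp.res (𝒢.brHom b v h)).obj (A.objV M v) :=
  BTemp.isoOfEquiv (A.exists_glueEquiv hM hdvd b v h).choose
    (A.exists_glueEquiv hM hdvd b v h).choose_spec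

/-- The **trivialising covering** attached to an approximator `G → G'` (proof of Prop. 2.5 (i),
p. 27): "a finite étale covering of `G` each of whose constituent anabelioids is trivial [over
`G'`]" — over `c`, the union of `M/[π̂₁(G'_c) : 1]` copies of the universal covering of `G'_c`, the
copies glued along the branches. An object of `B^cov(G)`. [cite: MochizukiSemiAnbd2006, Prop 2.5 p.27] -/
noncomputable def trivCov (hM : 0 < M) (hdvd : ∀ w, Nat.card (A.FV w) ∣ M) : CovObj 𝒢 where
  SV w := A.objV M w
  SE e := A.objE M e
  glue b v h := A.glue hM hdvd b v h

/-- The trivialising covering is a finite object. [cite: MochizukiSemiAnbd2006, Prop 2.5 p.27] -/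
theorem trivCov_isFinite (hM : 0 < M) (hdvd : ∀ w, Nat.card (A.FV w) ∣ M) :
    (A.trivCov hM hdvd).IsFinite :=
  ⟨fun w => inferInstanceAs (Finite (A.FV w × Fin (A.multV M w))),
    fun e => inferInstanceAs (Finite (A.FE e × Fin (A.multE M e)))⟩

/-- The trivialising covering has nonempty fibres. [cite: MochizukiSemiAnbd2006, Prop 2.5 p.27] -/
theorem trivCov_hasNonemptyFibres (hM : 0 < M) (hdvd : ∀ w, Nat.card (A.FV w) ∣ M) :
    (A.trivCov hM hdvd).HasNonemptyFibres :=
  ⟨fun w => ⟨((1 : A.FV w), (⟨0, lt_max_of_lt_left Nat.one_pos⟩ : Fin (A.multV M w)))⟩,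
    fun e => ⟨((1 : A.FE e), (⟨0, lt_max_of_lt_left Nat.one_pos⟩ : Fin (A.multE M e)))⟩⟩

/-- The trivialising covering splits itself at every point: the stabiliser of any point of a
constituent is the kernel of `Π_c → Π'_c`, which acts trivially on that constituent.
[cite: MochizukiSemiAnbd2006, Def 3.5(ii) p.37] -/
theorem trivCov_splitsAt_self (hM : 0 < M) (hdvd : ∀ w, Nat.card (A.FV w) ∣ M)
    (q : (A.trivCov hM hdvd).Point) : (A.trivCov hM hdvd).SplitsAt (A.trivCov hM hdvd) q := by
  rcases q with ⟨w, s⟩ | ⟨e, s⟩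
  · intro x g hx
    change (A.πV w g * x.1, x.2) = x at hx
    change (A.πV w g * s.1, s.2) = s
    rw [Prod.ext_iff, and_iff_left rfl] at hx ⊢
    rw [mul_eq_right.mp hx, one_mul]
  · intro x g hx
    change (A.πE e g * x.1, x.2) = x at hx
    change (A.πE e g * s.1, s.2) = s
    rw [Prod.ext_iff, and_iff_left rfl] at hx ⊢
    rw [mul_eq_right.mp hx, one_mul]

/-- The trivialising covering is TEMPERED (indeed finite étale: it is split by itself).
[cite: MochizukiSemiAnbd2006, Def 3.5(ii) p.37] -/
theorem trivCov_isTempered (hM : 0 < M) (hdvd : ∀ w, Nat.card (A.FV w) ∣ M) :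
    (A.trivCov hM hdvd).IsTempered := fun _ =>
  ⟨A.trivCov hM hdvd, A.trivCov_isFinite hM hdvd, A.trivCov_hasNonemptyFibres hM hdvd,
    fun q _ => A.trivCov_splitsAt_self hM hdvd q⟩

end Approximator

end ProfiniteSemiGraph


/-! ### Theorem 3.7 (i) (p. 40): the verticial homomorphisms are injective -/

namespace ProfiniteSemiGraph

variable {𝒢 : ProfiniteSemiGraph.{u}}

/-- An element of the kernel of a verticial homomorphism `ψ : Π_v → π₁^temp(G)` acts trivially on
the `v`-constituent `S_v` of every tempered covering `S`: by the defining isomorphism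
`B^temp(G) → G_v^⊤ ≅ B^temp(ψ)` (transported along the chart), `S_v ≅ ψ^*` (chart image of `S`).
[cite: MochizukiSemiAnbd2006, Thm 3.7(i) p.40] -/
theorem IsVerticialHom.ρ_eq_self_of_map_eq_one {c : TemperedPiChart 𝒢} {v : 𝒢.graph.Vertex}
    {ψ : 𝒢.Gv v →ₜ* c.G} (hψ : IsVerticialHom c v ψ) {g : 𝒢.Gv v} (hg : ψ g = 1)
    (S : BTempCat 𝒢) (s : (S.obj.SV v).obj.V) : (S.obj.SV v).obj.ρ g s = s := by
  obtain ⟨e⟩ := hψ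
  have i : S.obj.SV v ≅ (BTemp.res ψ).obj (c.equiv.functor.obj S) :=
    (ObjectProperty.ι _ ⋙ restrictV 𝒢 v).mapIso (c.equiv.unitIso.app S) ≪≫
      e.app (c.equiv.functor.obj S)
  exact BTemp.ρ_eq_self_of_iso_res ψ i hg s

/-- **Theorem 3.7 (i), injectivity** ([SemiAnbd] p. 40: "there is a natural continuous, injective
outer homomorphism `π̂₁(G_v) ↪ π₁^temp(G)`"): for `G` quasi-coherent (Def. 2.3 (iii)), every
verticial homomorphism `ψ : Π_v → π₁^temp(G)` is injective. Proof (the argument of Prop. 2.5 (i),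
p. 27, run in `B^temp(G)`): for `g ≠ 1` choose an open normal `U ∌ g`; quasi-coherence applied to
`Π_v/U` (and one-point coverings elsewhere) gives an approximator `G → G'` with
`Ker(Π_v → Π'_v) ⊆ U`; its trivialising covering is tempered and `g` moves its `v`-points, whereas
`Ker ψ` fixes the `v`-constituent of every tempered covering.
[cite: MochizukiSemiAnbd2006, Thm 3.7(i) p.40] -/
theorem verticialHom_injective (h𝒢 : 𝒢.IsQuasiCoherent) (c : TemperedPiChart 𝒢)
    (v : 𝒢.graph.Vertex) (ψ : 𝒢.Gv v →ₜ* c.G) (hψ : IsVerticialHom c v ψ) :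
    Function.Injective ψ := by
  classical
  rw [injective_iff_map_eq_one]
  intro g hg
  by_contra hg1
  -- an open normal subgroup of `Π_v` missing `g`
  obtain ⟨U, hU⟩ := ProfiniteGrp.exist_openNormalSubgroup_sub_open_nhds_of_one
    (isOpen_compl_singleton (x := g)) (by simpa using fun h => hg1 h.symm)
  have hgU : g ∉ (U : Set (𝒢.Gv v)) := fun h => hU h rfl
  -- the finite coverings `Π_w/N_w` fed to quasi-coherence: `N_v = U`, `N_w = Π_w` otherwise
  let N : ∀ w : 𝒢.graph.Vertex, Subgroup (𝒢.Gv w) :=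
    Function.update (fun w => (⊤ : Subgroup (𝒢.Gv w))) v U.toSubgroup
  have hNv : N v = U.toSubgroup := by
    simp only [N, Function.update_self]
  have hNw : ∀ w, w ≠ v → N w = ⊤ := fun w hw => by
    simp only [N, Function.update_of_ne hw]
  have hNopen : ∀ w, IsOpen (N w : Set (𝒢.Gv w)) := by
    intro w
    by_cases hw : w = v
    · subst hw
      rw [hNv]
      exact U.isOpen
    · rw [hNw w hw, Subgroup.coe_top]
      exact isOpen_univ
  let HV : ∀ w, BTemp (𝒢.Gv w) := fun w =>
    ⟨Action.ofMulAction (𝒢.Gv w) (𝒢.Gv w ⧸ N w),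
      (temperedAction_quotient_iff IsTempered.of_profinite (N w)).mpr (hNopen w)⟩
  let HE : ∀ e, BTemp (𝒢.Ge e) := fun e =>
    ⟨Action.ofMulAction (𝒢.Ge e) (𝒢.Ge e ⧸ (⊤ : Subgroup (𝒢.Ge e))),
      (temperedAction_quotient_iff IsTempered.of_profinite ⊤).mpr
        (by rw [Subgroup.coe_top]; exact isOpen_univ)⟩
  haveI hfinU : Finite (𝒢.Gv v ⧸ U.toSubgroup) :=
    Subgroup.quotient_finite_of_isOpen _ U.isOpen
  have hM1 : 1 ≤ Nat.card (𝒢.Gv v ⧸ U.toSubgroup) := Nat.card_pos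
  have hV : ∀ w, Nat.card (HV w).obj.V ≤ Nat.card (𝒢.Gv v ⧸ U.toSubgroup) ∧
      Finite (HV w).obj.V := by
    intro w
    change Nat.card (𝒢.Gv w ⧸ N w) ≤ _ ∧ Finite (𝒢.Gv w ⧸ N w)
    by_cases hw : w = v
    · subst hw
      rw [hNv]
      exact ⟨le_rfl, hfinU⟩
    · rw [hNw w hw]
      haveI : Subsingleton (𝒢.Gv w ⧸ (⊤ : Subgroup (𝒢.Gv w))) :=
        QuotientGroup.subsingleton_quotient_top
      exact ⟨(Finite.card_le_one_iff_subsingleton.mpr inferInstance).trans hM1, inferInstance⟩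
  have hE : ∀ e, Nat.card (HE e).obj.V ≤ Nat.card (𝒢.Gv v ⧸ U.toSubgroup) ∧
      Finite (HE e).obj.V := fun e => by
    haveI : Subsingleton (𝒢.Ge e ⧸ (⊤ : Subgroup (𝒢.Ge e))) :=
      QuotientGroup.subsingleton_quotient_top
    change Nat.card (𝒢.Ge e ⧸ (⊤ : Subgroup (𝒢.Ge e))) ≤ _ ∧
      Finite (𝒢.Ge e ⧸ (⊤ : Subgroup (𝒢.Ge e)))
    exact ⟨(Finite.card_le_one_iff_subsingleton.mpr inferInstance).trans hM1, inferInstance⟩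
  obtain ⟨A, hAV, -⟩ := h𝒢 _ HV HE hV hE
  -- `Ker(Π_v → Π'_v) ⊆ U`
  have hker : ∀ x : 𝒢.Gv v, A.πV v x = 1 → x ∈ U := by
    intro x hx
    have h1 := hAV v x hx ((1 : 𝒢.Gv v) : 𝒢.Gv v ⧸ N v)
    change x • ((1 : 𝒢.Gv v) : 𝒢.Gv v ⧸ N v) = ((1 : 𝒢.Gv v) : 𝒢.Gv v ⧸ N v) at h1
    rw [MulAction.Quotient.smul_mk, smul_eq_mul, mul_one, QuotientGroup.eq, mul_one,
      inv_mem_iff, hNv] at h1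
    exact h1
  have hgπ : A.πV v g ≠ 1 := fun h => hgU (hker g h)
  -- the trivialising covering of `A`: tempered, and `g` moves its `v`-points
  obtain ⟨M, hM, hdvd⟩ := A.bounded
  let S : BTempCat 𝒢 := ⟨A.trivCov hM hdvd, A.trivCov_isTempered hM hdvd⟩
  let s : A.FV v × Fin (A.multV M v) := (1, ⟨0, lt_max_of_lt_left Nat.one_pos⟩)
  have hfix := hψ.ρ_eq_self_of_map_eq_one hg S s
  have h2 := congrArg Prod.fst hfix
  change A.πV v g * 1 = 1 at h2
  rw [mul_one] at h2
  exact hgπ h2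

/-- **Theorem 3.7 (i)**, injectivity, under the standing hypotheses of Theorem 3.7.
[cite: MochizukiSemiAnbd2006, Thm 3.7(i) p.40] -/
theorem verticialHom_injective_of_thm37Hypotheses (h : 𝒢.Thm37Hypotheses) (c : TemperedPiChart 𝒢)
    (v : 𝒢.graph.Vertex) (ψ : 𝒢.Gv v →ₜ* c.G) (hψ : IsVerticialHom c v ψ) :
    Function.Injective ψ :=
  verticialHom_injective h.isQuasiCoherent c v ψ hψ

/-- A verticial subgroup is an isomorphic [injective, continuous] copy of `Π_v`
(Thm. 3.7 (i) p. 40), for `G` quasi-coherent. [cite: MochizukiSemiAnbd2006, Thm 3.7(i) p.40] -/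
theorem exists_injective_of_mem_verticialSubgroups (h𝒢 : 𝒢.IsQuasiCoherent)
    (c : TemperedPiChart 𝒢) (v : 𝒢.graph.Vertex) (H : Subgroup c.G)
    (hH : H ∈ verticialSubgroups c v) :
    ∃ φ : 𝒢.Gv v →ₜ* c.G, IsVerticialHom c v φ ∧ Function.Injective φ ∧
      H = φ.toMonoidHom.range := by
  obtain ⟨φ, hφ, rfl⟩ := hH
  exact ⟨φ, hφ, verticialHom_injective h𝒢 c v φ hφ, rfl⟩

/-- **Theorem 3.7 (i)** REDUCED to its existence clause: the named fact `VerticialInjective` holds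
as soon as every vertex carries a verticial homomorphism (the "natural continuous … outer
homomorphism `π̂₁(G_v) → π₁^temp(G)`", which is Proposition 3.2 applied to the morphism of
temperoids `B^temp(G) → G_v^⊤`) — the injectivity clause being `verticialHom_injective`.
[cite: MochizukiSemiAnbd2006, Thm 3.7(i) p.40] -/
theorem verticialInjective_iff_nonempty :
    VerticialInjective.{u} ↔
      ∀ (𝒢 : ProfiniteSemiGraph.{u}), 𝒢.Thm37Hypotheses →
        ∀ (c : TemperedPiChart 𝒢) (v : 𝒢.graph.Vertex), (verticialSubgroups c v).Nonempty :=
  ⟨fun h 𝒢 h𝒢 c v => (h 𝒢 h𝒢 c v).1, fun h 𝒢 h𝒢 c v =>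
    ⟨h 𝒢 h𝒢 c v, fun φ hφ => verticialHom_injective h𝒢.isQuasiCoherent c v φ hφ⟩⟩

end ProfiniteSemiGraph

end Literature.AnabelianGeometry.SemiGraphs
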